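import Mathlib
import HarnessLib
import HarnessLib.Audit

/-!
# SoloInformed — Gauss triplication by the moves, I: the tangential map of the pencil `xy(1−x−y) = F`

Pure real algebra behind the π-free four-rule chain for the index-`3` multiplication formula
`B(⅓,s)·B(⅔,s) = 3^{3s−1}·B(s,s)·B(2s,s)` (route item `MultiplicationAccessible`, instance
`m = 2`, of summit KontsevichZagierPeriods; hypothesis `hM` of
`KZ.gaussMultiplication_toFormalPeriod 2 s`).

The affine cubics `E_F : xyz = F`, `x + y + z = 1` (`0 < F < 1/27`) form the Hesse-type pencil
spanned by the triangle `xyz = 0` and the tripled line at infinity; the flex `O = (1 : −1 : 0)`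
lies on every member, `−P` is the swap `(x,y,z) ↦ (y,x,z)`, and the **tangential map**
`P ↦ [−2]P` (third intersection of the tangent at `P`) is the RATIONAL self-map of the plane
`Ψ(x, y, z) = (x(y−z)³ : y(z−x)³ : z(x−y)³)`, affinely
`Ψ(x,y) = (−x(y−z)²/((x−y)(x−z)), −y(z−x)²/((y−x)(y−z)))`, `z = 1 − x − y`
(`soloInformedTanX`, `soloInformedTanY`). We prove, by `ring`/`field_simp` only:

* `Ψ` preserves the pencil: `F ∘ Ψ = F` (`soloInformed_hesseF_tan`), third coordinate
  `1 − Ψ_x − Ψ_y = −z(x−y)²/((z−x)(z−y))` (`soloInformed_tan_third`);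
* its `x`-coordinate depends on `x` and `F` alone: `Ψ_x = ρ_F(x) := −q_F(x)/D_F(x)` with
  `q_F(x) = x⁴ − 2x³ + x² − 4Fx = x²(y−z)²` and `D_F(x) = 2x³ − x² + F = x(x−y)(x−z)` on `E_F`
  (`soloInformed_rhoQ_hesse`, `soloInformed_rhoD_hesse`, `soloInformed_tanX_eq_rho`) — a Lattès map
  of the `x`-line;
* the Jacobian determinant of `Ψ` is the CONSTANT `−2` (`soloInformed_tanJ_det`; the coordinate
  shadow of `[−2]^*ω = −2ω` for `ω = dx/(x(z−y)) = dx/√q_F(x)`), and the one-variable shadow, the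
  **key identity** `ρ_F′(x)² · q_F(x) = 4 · q_F(ρ_F(x))` (`soloInformed_rho_key`);
* signs on the Weyl chamber `C₀ = {0 < x < z < y}` (`x` minimal, `z` the median): `Ψ_x < 0`,
  `Ψ_y < 0`, and `0 < F < 1/27` there (`soloInformed_hesseF_lt`: AM–GM, strict off the centre).

Companions: `SoloInformedHesseRho` (the map `ρ_F` is a bijection from the `x`-range of `C₀` onto
`(−∞,0)`), `SoloInformedHesseTangentialChart` (rule (2) along `Ψ`: `6κ·[C₀, F^{s−1}] ∼
[B₃′, 3κF^{s−1}]`), `SoloInformedBoxFold`, `SoloInformedTriplication`.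
Residency `solo-KontsevichZagierPeriods-informed` (s71); paper §7 (c6)(x).

References: Kontsevich–Zagier, *Periods* (2001), §1.2; J. H. Silverman, *The Arithmetic of Elliptic
Curves*, III.2 (chord–tangent law), III.5 (invariant differential); Andrews–Askey–Roy, *Special
Functions* (1999), Thm 1.5.2 (Gauss multiplication).
-/

noncomputable section

open Set
namespace Summit.KontsevichZagierPeriods.KontsevichZagierPeriods.Theorems

/-! ### The pencil function and the tangential map -/

/-- `F(x,y) = x·y·(1 − x − y)`, the affine equation of the pencil `xyz = F`, `x + y + z = 1`.
[this work] -/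
def soloInformedHesseF (x y : ℝ) : ℝ := x * y * (1 - x - y)

/-- `Ψ_x(x,y) = −x(y−z)²/((x−y)(x−z))` with `z = 1−x−y` (`y − z = x + 2y − 1`,
`x − z = 2x + y − 1`). [this work] -/
def soloInformedTanX (x y : ℝ) : ℝ := -x * (x + 2 * y - 1) ^ 2 / ((x - y) * (2 * x + y - 1))

/-- `Ψ_y(x,y) = −y(z−x)²/((y−x)(y−z)) = y(x−z)²/((x−y)(y−z))`. [this work] -/
def soloInformedTanY (x y : ℝ) : ℝ := y * (2 * x + y - 1) ^ 2 / ((x - y) * (x + 2 * y - 1))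

/-- `q_F(x) = x⁴ − 2x³ + x² − 4Fx = x(x(1−x)² − 4F)`. [this work] -/
def soloInformedRhoQ (F x : ℝ) : ℝ := x ^ 4 - 2 * x ^ 3 + x ^ 2 - 4 * F * x

/-- `D_F(x) = 2x³ − x² + F`. [this work] -/
def soloInformedRhoD (F x : ℝ) : ℝ := 2 * x ^ 3 - x ^ 2 + F

/-- The Lattès map `ρ_F(x) = −q_F(x)/D_F(x)` (`x`-coordinate of `[−2]`). [this work] -/
def soloInformedRho (F x : ℝ) : ℝ := -soloInformedRhoQ F x / soloInformedRhoD F x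

/-- `ρ_F′(x) = −(q′D − qD′)/D²`. [this work] -/
def soloInformedRho' (F x : ℝ) : ℝ :=
  -((4 * x ^ 3 - 6 * x ^ 2 + 2 * x - 4 * F) * soloInformedRhoD F x -
      soloInformedRhoQ F x * (6 * x ^ 2 - 2 * x)) / soloInformedRhoD F x ^ 2

/-- On the pencil, `q_F(x) = x²(y − z)²`. [this work] -/
theorem soloInformed_rhoQ_hesse (x y : ℝ) :
    soloInformedRhoQ (soloInformedHesseF x y) x = x ^ 2 * (x + 2 * y - 1) ^ 2 := by
  unfold soloInformedRhoQ soloInformedHesseF; ring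

/-- On the pencil, `D_F(x) = x(x − y)(x − z)`. [this work] -/
theorem soloInformed_rhoD_hesse (x y : ℝ) :
    soloInformedRhoD (soloInformedHesseF x y) x = x * (x - y) * (2 * x + y - 1) := by
  unfold soloInformedRhoD soloInformedHesseF; ring

/-- `Ψ_x = ρ_F(x)`: the `x`-coordinate of the tangential depends on `x` and `F` only.
[this work] -/
theorem soloInformed_tanX_eq_rho {x y : ℝ} (hx : x ≠ 0) (hd : x - y ≠ 0) (hn : 2 * x + y - 1 ≠ 0) :
    soloInformedTanX x y = soloInformedRho (soloInformedHesseF x y) x := by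
  have hn' : x * 2 + y - 1 ≠ 0 := fun h => hn (by linarith)
  rw [soloInformedRho, soloInformed_rhoQ_hesse, soloInformed_rhoD_hesse, soloInformedTanX,
    div_eq_div_iff (mul_ne_zero hd hn) (mul_ne_zero (mul_ne_zero hx hd) hn)]
  ring

/-- By the symmetry `x ↔ y`: `Ψ_y(x,y) = Ψ_x(y,x) = ρ_F(y)`. [this work] -/
theorem soloInformed_tanY_eq_tanX_swap (x y : ℝ) :
    soloInformedTanY x y = soloInformedTanX y x := by
  unfold soloInformedTanY soloInformedTanX
  rw [show (y - x) * (2 * y + x - 1) = -((x - y) * (x + 2 * y - 1)) by ring,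
    show (y + 2 * x - 1) = (2 * x + y - 1) by ring, div_neg]
  ring

/-- The third coordinate of the tangential: `1 − Ψ_x − Ψ_y = −z(x−y)²/((z−x)(z−y))`
(the identity `x(y−z)³ + y(z−x)³ + z(x−y)³ = (x+y+z)(x−y)(y−z)(z−x)`). [this work] -/
theorem soloInformed_tan_third {x y : ℝ} (hd : x - y ≠ 0) (hm : x + 2 * y - 1 ≠ 0)
    (hn : 2 * x + y - 1 ≠ 0) :
    1 - soloInformedTanX x y - soloInformedTanY x y =
      -(1 - x - y) * (x - y) ^ 2 / ((2 * x + y - 1) * (x + 2 * y - 1)) := by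
  have hn' : x * 2 + y - 1 ≠ 0 := fun h => hn (by linarith)
  have hm' : x + y * 2 - 1 ≠ 0 := fun h => hm (by linarith)
  unfold soloInformedTanX soloInformedTanY
  field_simp
  ring

/-- **`Ψ` preserves the pencil**: `F(Ψ(x,y)) = F(x,y)`. [this work] -/
theorem soloInformed_hesseF_tan {x y : ℝ} (hd : x - y ≠ 0) (hm : x + 2 * y - 1 ≠ 0)
    (hn : 2 * x + y - 1 ≠ 0) :
    soloInformedHesseF (soloInformedTanX x y) (soloInformedTanY x y) = soloInformedHesseF x y := by
  have h3 := soloInformed_tan_third hd hm hn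
  have hn' : x * 2 + y - 1 ≠ 0 := fun h => hn (by linarith)
  have hm' : x + y * 2 - 1 ≠ 0 := fun h => hm (by linarith)
  unfold soloInformedHesseF
  rw [show 1 - soloInformedTanX x y - soloInformedTanY x y =
      -(1 - x - y) * (x - y) ^ 2 / ((2 * x + y - 1) * (x + 2 * y - 1)) from h3]
  unfold soloInformedTanX soloInformedTanY
  field_simp

/-! ### Signs on the chamber `C₀ = {0 < x < z < y}` -/

/-- On `C₀`: `Ψ_x < 0`. [this work] -/
theorem soloInformed_tanX_neg {x y : ℝ} (hx : 0 < x) (hxz : x < 1 - x - y) (hzy : 1 - x - y < y) :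
    soloInformedTanX x y < 0 := by
  unfold soloInformedTanX
  have hd : x - y < 0 := by linarith
  have hn : 2 * x + y - 1 < 0 := by linarith
  have hm : 0 < x + 2 * y - 1 := by linarith
  have hden : 0 < (x - y) * (2 * x + y - 1) := mul_pos_of_neg_of_neg hd hn
  apply div_neg_of_neg_of_pos _ hden
  have : 0 < x * (x + 2 * y - 1) ^ 2 := mul_pos hx (pow_pos hm 2)
  linarith

/-- On `C₀`: `Ψ_y < 0`. [this work] -/
theorem soloInformed_tanY_neg {x y : ℝ} (hx : 0 < x) (hxz : x < 1 - x - y) (hzy : 1 - x - y < y) :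
    soloInformedTanY x y < 0 := by
  unfold soloInformedTanY
  have hd : x - y < 0 := by linarith
  have hn : 2 * x + y - 1 < 0 := by linarith
  have hm : 0 < x + 2 * y - 1 := by linarith
  have hy : 0 < y := by linarith
  have hden : (x - y) * (x + 2 * y - 1) < 0 := mul_neg_of_neg_of_pos hd hm
  apply div_neg_of_pos_of_neg _ hden
  have : 0 < (2 * x + y - 1) ^ 2 := by nlinarith
  exact mul_pos hy this

/-- AM–GM on the simplex, strict off the centre: `xyz < 1/27` when `x + y + z = 1`, `x,y,z > 0`,
`x ≠ y` (`(x+y+z)³ − 27xyz = (x+y+z)·Σ(x−y)²/2 + 3Σ x(y−z)²`). [folklore] -/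
theorem soloInformed_hesseF_lt {x y : ℝ} (hx : 0 < x) (hy : 0 < y) (hz : 0 < 1 - x - y)
    (hxy : x ≠ y) : soloInformedHesseF x y < 1 / 27 := by
  unfold soloInformedHesseF
  have hsq : 0 < (x - y) ^ 2 := by
    have : x - y ≠ 0 := sub_ne_zero.2 hxy
    positivity
  have e : 1 - 27 * (x * y * (1 - x - y)) =
      (1 / 2) * ((x - y) ^ 2 + (y - (1 - x - y)) ^ 2 + ((1 - x - y) - x) ^ 2) +
        3 * (x * (y - (1 - x - y)) ^ 2 + y * ((1 - x - y) - x) ^ 2 + (1 - x - y) * (x - y) ^ 2) := by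
    ring
  nlinarith [e, hsq, sq_nonneg (y - (1 - x - y)), sq_nonneg ((1 - x - y) - x),
    mul_nonneg hx.le (sq_nonneg (y - (1 - x - y))), mul_nonneg hy.le (sq_nonneg ((1 - x - y) - x)),
    mul_pos hz hsq]

/-- On `C₀`: `0 < F`. [this work] -/
theorem soloInformed_hesseF_pos {x y : ℝ} (hx : 0 < x) (hy : 0 < y) (hz : 0 < 1 - x - y) :
    0 < soloInformedHesseF x y := by
  unfold soloInformedHesseF; positivity

/-! ### The Jacobian of `Ψ` is `−2` -/

/-- `∂Ψ_x/∂x`. [this work] -/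
def soloInformedTanJ11 (x y : ℝ) : ℝ :=
  -(x + 2 * y - 1) * (((x + 2 * y - 1) + 2 * x) * (x - y) * (2 * x + y - 1) -
    x * (x + 2 * y - 1) * ((2 * x + y - 1) + 2 * (x - y))) / ((x - y) * (2 * x + y - 1)) ^ 2

/-- `∂Ψ_x/∂y`. [this work] -/
def soloInformedTanJ12 (x y : ℝ) : ℝ :=
  -x * (x + 2 * y - 1) * (4 * (x - y) * (2 * x + y - 1) -
    (x + 2 * y - 1) * ((x - y) - (2 * x + y - 1))) / ((x - y) * (2 * x + y - 1)) ^ 2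

/-- `∂Ψ_y/∂x`. [this work] -/
def soloInformedTanJ21 (x y : ℝ) : ℝ :=
  y * (2 * x + y - 1) * (4 * (x - y) * (x + 2 * y - 1) -
    (2 * x + y - 1) * ((x + 2 * y - 1) + (x - y))) / ((x - y) * (x + 2 * y - 1)) ^ 2

/-- `∂Ψ_y/∂y`. [this work] -/
def soloInformedTanJ22 (x y : ℝ) : ℝ :=
  (2 * x + y - 1) * (((2 * x + y - 1) + 2 * y) * (x - y) * (x + 2 * y - 1) -
    y * (2 * x + y - 1) * (2 * (x - y) - (x + 2 * y - 1))) / ((x - y) * (x + 2 * y - 1)) ^ 2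

/-- **`det DΨ = −2`** identically (off the three medians). [this work] -/
theorem soloInformed_tanJ_det {x y : ℝ} (hd : x - y ≠ 0) (hm : x + 2 * y - 1 ≠ 0)
    (hn : 2 * x + y - 1 ≠ 0) :
    soloInformedTanJ11 x y * soloInformedTanJ22 x y -
      soloInformedTanJ12 x y * soloInformedTanJ21 x y = -2 := by
  have hn' : x * 2 + y - 1 ≠ 0 := fun h => hn (by linarith)
  have hm' : x + y * 2 - 1 ≠ 0 := fun h => hm (by linarith)
  unfold soloInformedTanJ11 soloInformedTanJ22 soloInformedTanJ12 soloInformedTanJ21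
  field_simp
  ring

/-! ### The one-variable shadow: the key identity for `ρ_F` -/

/-- `ρ_F` is differentiable off the zeros of `D_F`, with derivative `ρ_F′`. [this work] -/
theorem soloInformed_hasDerivAt_rho {F x : ℝ} (hD : soloInformedRhoD F x ≠ 0) :
    HasDerivAt (soloInformedRho F) (soloInformedRho' F x) x := by
  have hq : HasDerivAt (fun t => t ^ 4 - 2 * t ^ 3 + t ^ 2 - 4 * F * t)
      (4 * x ^ 3 - 6 * x ^ 2 + 2 * x - 4 * F) x := by
    have h := (((hasDerivAt_pow 4 x).sub ((hasDerivAt_pow 3 x).const_mul 2)).add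
      (hasDerivAt_pow 2 x)).sub ((hasDerivAt_id' x).const_mul (4 * F))
    refine h.congr_deriv ?_
    push_cast
    ring
  have hd : HasDerivAt (fun t => 2 * t ^ 3 - t ^ 2 + F) (6 * x ^ 2 - 2 * x) x := by
    have h := (((hasDerivAt_pow 3 x).const_mul 2).sub (hasDerivAt_pow 2 x)).add_const F
    refine h.congr_deriv ?_
    push_cast
    ring
  have hD' : 2 * x ^ 3 - x ^ 2 + F ≠ 0 := hD
  have h := (hq.fun_neg).fun_div hd hD'
  have e : soloInformedRho F =
      fun t => -(t ^ 4 - 2 * t ^ 3 + t ^ 2 - 4 * F * t) / (2 * t ^ 3 - t ^ 2 + F) := by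
    funext t; rfl
  rw [e]
  refine h.congr_deriv ?_
  unfold soloInformedRho' soloInformedRhoQ soloInformedRhoD
  ring

/-- **Key identity** `ρ_F′(x)²·q_F(x) = 4·q_F(ρ_F(x))` (`[−2]^*ω = −2ω` on the `x`-line).
[this work] -/
theorem soloInformed_rho_key {F x : ℝ} (hD : soloInformedRhoD F x ≠ 0) :
    soloInformedRho' F x ^ 2 * soloInformedRhoQ F x = 4 * soloInformedRhoQ F (soloInformedRho F x) := by
  unfold soloInformedRho' soloInformedRho soloInformedRhoQ
  generalize hDD : soloInformedRhoD F x = DD at *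
  field_simp
  subst hDD
  unfold soloInformedRhoD
  ring

/-- `q_F > 0` on `(−∞, 0)` when `F > 0`. [this work] -/
theorem soloInformed_rhoQ_pos_of_neg {F x : ℝ} (hF : 0 < F) (hx : x < 0) :
    0 < soloInformedRhoQ F x := by
  unfold soloInformedRhoQ
  have h1 : 0 < -4 * F * x := by nlinarith
  nlinarith [sq_nonneg (x ^ 2 - x), sq_nonneg x]

end Summit.KontsevichZagierPeriods.KontsevichZagierPeriods.Theorems
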